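import Literature.MathematicalPhysics.QuantumFieldTheory.Balaban1983to89.B8Thm2TorusAtSupplier
import Literature.MathematicalPhysics.QuantumFieldTheory.Balaban1983to89.B8LeafKnitZd3LettersRDB

/-!
# `Balaban1983to89.B8Thm2TorusLetters` — [Balaban1985RegularSpaces] THEOREM 2 (p. 83) ON THE TORUS `Ω_j = T_η`: THE LETTER BUNDLE
# `LettersAt` OF [4] = [Balaban1985BackgroundPropagators] Thms 3.1–3.3 AT ONE BACKGROUND `U₀`, AND THE FOUR SOCKETS OF THE `ℤᵈ` KNIT AT
# THE TORUS MEMBERS SERVED FROM IT (sub-row «G-B8-T2S», module **M3** of `lit-balaban-p33/T2S-MAP.md`; lead g29 JOINT RULING #2 (R1))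

statement-level skeleton of published theorems with citation tags; proofs where landed; nothing here is a claim about the
Yang–Mills mass gap

T. Bałaban, *Spaces of regular gauge field configurations on a lattice and gauge fixing conditions*, Commun. Math. Phys. **99** (1985)
75–102 `[Balaban1985RegularSpaces]` ("B8"; printed page = PDF page + 74): Theorem 2 p. 83, Proposition 3 (1.57)–(1.59) pp. 86–87, Sect. D
(1.86)–(1.103) pp. 91–93, Proposition 5 (1.106)–(1.109) p. 94, Theorem 4 p. 88.  [4] = T. Bałaban, *Propagators for lattice gauge theories in
a background field*, Commun. Math. Phys. **99** (1985) 389–434 `[Balaban1985BackgroundPropagators]` ("B9"): Theorems 3.1–3.3 pp. 397–399,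
(3.20)–(3.27) pp. 394–395.  STATUS: published, refereed.

CITATION HEADER (lean-in-tree rule).  Cell `lit-balaban`, seat `lit-balaban-t2s-1` (gen 0), sub-row «G-B8-T2S» = the [B8] §3 THEOREM 2 TORUS
SUPPLIER for R3 `stmt-QuantumFields-19200` (ym3 ★★OWNER WANTED W-19200-T2), module **M3** of the map of record `lit-balaban-p33/T2S-MAP.md`
(lead g29 2026-08-28T00:11:16Z (1); JOINT RULING #2 (R1) 00:46:36Z).  WHAT IS REPRODUCED.  The two landed socket-level suppliers of Theorem 2 on
the torus — route K `B8Thm2TorusAtSupplier.thm2TorusAt_exists_of_socketsE` (p33, over the n05 knit) and route P `B8Thm2TorusSupplier` (this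
seat, sockets as printed) — bottom out at [4]'s Theorems 3.1–3.3 FOR THE BACKGROUND `U₀`.  This file names that content ONCE, as ONE hypothesis
bundle per background:

* §1 **`LettersAt L … η m α₀ U₀`** — a `structure` (data + laws; no `… : Prop` fact) carrying, for ONE unitary background `U₀` on `ℤᵈ` (the torus
  `T_η` read periodically, `Ω_j = ℤᵈ` for every `j`, constraint structure `B8Thm4TorusAt.torusLam`) and ONE truncation `m`:
  (E) [4]'s LETTERS IN THE CURRENCY OF [B8] SECT. D at every truncation `1 ≤ n ≤ m` — `ℂ`-linear maps `Gp n = G′` ((1.95), [4] Thm 3.1),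
  `lapU n = Δ` (the covariant Laplacian (1.2)), `Qp n = Q′`, `QpT n = Q′ᵀ`, `Aw n = 𝔄` (the a-weights), `Cinv n = C = (Q′G′²Q′ᵀ)⁻¹` ((1.96)–(1.97),
  [4] Thm 3.2), `Hp n = H′` ((1.91)–(1.92)) — with the SIXTEEN laws of `B8SockLettersRD.SockLettersRD` VERBATIM at `(Ω := ℤᵈ, Λs := torusLam)`:
  the right-inverse law of `G′` pointwise, the law of `C` on the range of `Q′`, the three readings, (1.92) for `H′` (sup ∕ weighted gradient ∕
  `(−2)`-weighted Laplacian), Dirichlet range and reality of `H′`, `Q′H′ = 1` at the tower sites, (1.101) for `G′` (constant `B_G`), Dirichlet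
  range and reality of `G′`, (1.98) for `R = 1 − G′Q′ᵀCQ′G′` (constant `B_R`) and its reality;
  (U) the THREE additional laws the uniqueness half of Proposition 5 reads at the top structure `(m, torusLam m)` (`B8LeafKnitZd3LettersRDB`'s
  guarded binder `SLetUB`): the left-inverse law of `G′` ON BOUNDED FUNCTIONS ([4] Thm 3.1 as printed), the law of `C` in the `Q′ᵀ`-form, `Q′ = 0`
  off `𝔅_m` — for the SAME operators (print has one `G′(U₀)`);
  (B) the IN-EDGE b9 IN PROPOSITION 3's FRAME at truncation `m` = the body of `B8LeafModelZd3.SockB9P3` AT `U₀`: for every field `W` near `U₀`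
  in the Landau gauge of record with `W = e^{iηA′}`, `|A′| ≤ α₂(Lʲη)⁻¹`, the FIVE lines of (1.59) («Theorem 3.3 of [4] implies the bounds (1.59)»,
  p. 86), the fifth = the Hölder line at ONE explicit exponent `β` (β := 0 admissible) with constant `B₀β` and length function `len`.
  Field names follow the B9 owner's list (`lit-balaban-r06/B9-LETTERS-MAP.md` §6: `Gp`, `Cinv`, `Qp`∕`QpT`, `lapU`; laws `gp_…`, `cinv_…`,
  `hp_…`, `r_…`; the b9 block `b9P3`).
* §2 **`LettersAll … cL η k`** — the letters at EVERY truncation `m ≤ k` and EVERY unitary background `U₀ ∈ 𝔄_m({ℤᵈ}, α₀)`, `0 < α₀ ≤ cL`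
  (the binder the knit's sockets quantify over), and the SERVER LEMMAS in route K's currency: `sockLettersRD_of_letters`, `lettersUB_of_letters`,
  `sockB9P3_of_letters` (projections), the member laws of the torus index (`torus_member_laws`), and **`sockets_of_letters`** = the knit's
  `SockHFP₀`∕`SockHFP` (by `B8SockHFPRD.exists_threshold_sockHFP_pairRD`) and `SockP5uE` (by `B8SockP5uEAssemblyB.exists_threshold_sockP5uEB`)
  at EVERY torus member from `LettersAll` at that member, ONE threshold triple for all members.
* §3 **`thm2_torus_of_letters`** (Theorem 2, both halves, `zdGF3` currency = p33's `B8Thm2TorusMember.thm2_torus_of_socketsE` ∘ §2) and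
  **`thm2TorusAt_exists_of_letters_K`** (the existence half of the interface of record `B8Thm2TorusAt` in its own letters `Concl2T`, `G = unitaryUnits`,
  torus side `P = Lᵏ·N`, `β₀ = 0` = p33's `B8Thm2TorusAtSupplier.thm2TorusAt_exists_of_socketsE` ∘ §2): THEOREM 2 ON `T_η` LOCALISED TO THE [B9] §3
  LETTERS — the only hypotheses left are `LettersAll` at every torus member, the free-constant condition `3·(2dL²)·B_G·B_R ≤ B₀′` and positive constants.

## HONEST SCOPE — what is NOT claimed
(i) NOTHING of [4] is proved: `LettersAt` is a hypothesis bundle; its inhabitant at a general regular background is sub-row «G-B9-LETTERS»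
(`lit-balaban-r06/B9-LETTERS-MAP.md`, endpoint M5.9 `lettersAt_of_regular`).  (ii) CURRENCY: the fields are [4]'s theorems in the currency the
landed [B8] engines consume — Sect. D's letters `H′, 𝔄, C, R` with (1.92)∕(1.98)∕(1.101) and Prop. 3's (1.59) lines for Landau fields — i.e. ONE
STOREY ABOVE [B9] Thms 3.1–3.3 as printed (operators `G′(U)`, `G(U)` applied to `λ`, `J` with exponential decay); the bridge is [B8] pp. 86 and
91–93 ((1.58): `A = G(U₀)J + …`; (1.91)–(1.103)), of which the tree holds the (1.59) half abstractly (`B9SupplySockB9P3ZdAt*`, member-local binders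
`DictAt`…`HolderAt`) — G-B9-LETTERS meets these fields or lands that bridge.  (iii) INFINITE-VOLUME READING: backgrounds and fields live on `ℤᵈ`;
the knit's sockets (hence `LettersAll`) quantify over ALL unitary backgrounds of the class, periodic or not; the torus enters through the periodic
data of the consumer (route K's `B8Thm2TorusPeriodic`, route P's induction).  (iv) NOT HERE: shift-covariance of the letters (not needed — route K's
periodicity is by uniqueness, p589994) and the `𝔰`-preservation clause of joint J-SU (lead 00:11:16Z (3)); both belong to the route-P server
`thm2TorusSockets_of_letters` (Prop. 5's fixed point `G`-valued and periodic), which is NOT in this file: it needs the invariant-closed-set form of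
the contraction (`B8Prop5UniqKLevel.hFP_unique_kLevel` + covariance), a separate module.  (v) `d ≥ 2`, `L ≥ 2`, `𝔸` a C⋆-algebra; `G = unitaryUnits`
in §3 (SU(N): joint J-SU).  Count-neutral; `stub_PV3A` NOT discharged (it closes with M5.9 + the composition); nothing continuum ∕ ℝ⁴ ∕ OS ∕
mass-gap ∕ Clay.  No `sorry`, no `… : Prop` fact, no `instance`, no `notation`.
-/

noncomputable section

open NormedSpace

namespace Literature.MathematicalPhysics.QuantumFieldTheory.Balaban1983to89.B8Thm2TorusLetters

open B7Prop1Explicit B7Prop2Explicit B7Prop1Local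
open B7Eq92Concrete (mgauge)
open B7Eq78Linearization (zdBlocking QprimeIter)
open B8Ineq132 (covDerivFwd InAk BondTouches Under)
open B8Eq119TwistedAxial (bgT Restr129 InAx)
open B8Eq140Level (SideTouches)
open B8Eq138LandauZd (covLap QT IsLandau138W)
open B8Eq1117Concrete (XSpace)
open B8Prop5ContractionKLevel (Bd2)
open B8LambdaSpaceKLevel (wt)
open B8Eq184Proof (cfgExp)
open B8Lemma1NonAbelian (mulCfg)
open B8Eq146AExpansion (iEta plaqCovDeriv)
open B8Eq143PlaqExpansion (pdiv)
open B7Prop4GeneralLevels (linCovIter)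
open B8Eq155JBound (Jcur wsup)
open B8ScaledSupNorm (bondNorm msup)
open B9Eq340HolderZd (hquot AdmPair)
open B8Ineq130 (tlo thi)
open B8Thm2LogB (blockTop)
open B8Thm4TorusAt (torusLam mem_torusLam_iff torusLam_of_ne)
open B8Eq133Hypotheses (Hyp135)
open B8Thm2TorusAt (Concl2T)
open B12Ineq417Flat (shiftCfg)
open B8LeafModelZd (ZdIdx)
open B8LeafModelZdSockP5uE (SockP5uE)
open B8LeafModelZdOfHFP (SockHFP₀ SockHFP)
open B8LeafModelZd3 (zdGF3 SockB9P3 sockB9P3_anti)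
open B8SockLettersRD (SockLettersRD)
open B8SockHFPRD (exists_threshold_sockHFP_pairRD)
open B8SockP5uEAssemblyB (exists_threshold_sockP5uEB)
open B8Thm2TorusMember (TorusMember torusIdx torusLamb mem_torusLamb_iff thm2_torus_of_socketsE)
open B8Thm2TorusAtSupplier (thm2TorusAt_exists_of_socketsE)
open QuantumLattice (blockSites mem_blockSites_iff blockMap)

-- `Site` alone could resolve to the torus sites of `Setup.lean`; re-export the `ℤ^d` sites of `B7Prop1Explicit`.
export B7Prop1Explicit (Site)

variable {d : ℕ}

/-! ## §1  The letter bundle at one background -/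

section Bundle

variable {𝔸 : Type*} [CStarAlgebra 𝔸]

/-- **THE [4]-LETTERS AT ONE BACKGROUND `U₀` ON THE TORUS (`Ω_j = ℤᵈ`, constraint structure `torusLam`), TRUNCATION `m`, REGULARITY `α₀`.**
DATA (for every truncation `n`): `ℂ`-linear letters `Gp n = G′(U₀)` ((1.95); [4] Thm 3.1, the inverse of `Δ + Q′ᵀ𝔄Q′`), `lapU n = Δ` (the covariant
Laplacian (1.2)), `Qp n = Q′` (iterated averages, all levels `j ≤ n`), `QpT n = Q′ᵀ`, `Aw n = 𝔄` (the a-weights operator), `Cinv n = C =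
(Q′G′²Q′ᵀ)⁻¹` ((1.96)–(1.97); [4] Thm 3.2), `Hp n = H′` ((1.91)–(1.92), `Q′(H′X) = X`).  LAWS: (E) at every `1 ≤ n ≤ m` the SIXTEEN laws of
`B8SockLettersRD.SockLettersRD` verbatim at `(Ω := ℤᵈ, Λs := torusLam)` (`gp_right` … `r_real`); (U) at the top structure `(m, torusLam m)`, `1 ≤ m`,
the three further laws Proposition 5's uniqueness half reads (`gp_left_bdd`: [4] Thm 3.1's left-inverse law ON BOUNDED FUNCTIONS; `cinv_range'`;
`qp_zero_off`); (B) `b9P3`: the in-edge b9 in Proposition 3's frame at truncation `m` — for every unitary `W` with `U₀, WU₀ ∈ 𝔄_m({ℤᵈ}, α₀)`, the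
Landau condition of record (1.38) for `W`, `W = e^{iηA′}` with `A′` Hermitian and `|A′| ≤ α₂(Lʲη)⁻¹` (`0 < α₂ ≤ cB`), the FIVE lines of (1.59)
(`|A′|₍₋₁₎, |∇A′|₍₋₂₎, |D*DA′|₍₋₃₎, |ΔA′|₍₋₃₎ ≤ B₀(|J|₍₋₃₎ + |B₁|)` and the `β`-Hölder line with `B₀β`), `|B₁|` over ALL bonds of the top lattice
(`torusLamb m`) — the body of `B8LeafModelZd3.SockB9P3` at `U₀`.  A hypothesis bundle: [4] Theorems 3.1–3.3 for Bałaban's operators at `U₀`, in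
[B8]'s Sect. D ∕ Prop. 3 currency; nothing asserted.
[cite: Balaban1985RegularSpaces, (1.91)–(1.92) p.91, (1.95)–(1.98) p.92, (1.101)–(1.103) p.93, (1.57)–(1.59) p.86, Prop. 5 p.94; Balaban1985BackgroundPropagators, Thm 3.1 p.397, Thm 3.2 p.398, Thm 3.3 p.399, (3.25)–(3.27) pp.394–395] -/
structure LettersAt (L : ℕ) (BG BR B₀'H B₂' B₀ B₀β cB β : ℝ) (len : Site d → ℝ) (η : ℝ) (m : ℕ) (α₀ : ℝ)
    (U₀ : Site d → Fin d → 𝔸ˣ) where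
  /-- `G′(U₀)` at truncation `n` ((1.95); [4] Thm 3.1). -/
  Gp : ℕ → ((Site d → 𝔸) →ₗ[ℂ] (Site d → 𝔸))
  /-- the covariant Laplacian letter `Δ` at truncation `n` ((1.2)). -/
  lapU : ℕ → ((Site d → 𝔸) →ₗ[ℂ] (Site d → 𝔸))
  /-- `Q′(U₀)` at truncation `n` (all levels `j ≤ n`). -/
  Qp : ℕ → ((Site d → 𝔸) →ₗ[ℂ] (ℕ → Site d → 𝔸))
  /-- `Q′(U₀)ᵀ` at truncation `n`. -/
  QpT : ℕ → ((ℕ → Site d → 𝔸) →ₗ[ℂ] (Site d → 𝔸))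
  /-- the a-weights operator `𝔄` at truncation `n`. -/
  Aw : ℕ → ((ℕ → Site d → 𝔸) →ₗ[ℂ] (ℕ → Site d → 𝔸))
  /-- `C = (Q′G′²Q′ᵀ)⁻¹` at truncation `n` ((1.96)–(1.97); [4] Thm 3.2). -/
  Cinv : ℕ → ((ℕ → Site d → 𝔸) →ₗ[ℂ] (ℕ → Site d → 𝔸))
  /-- `H′(U₀)` at truncation `n` ((1.91)–(1.92)). -/
  Hp : (n : ℕ) → (XSpace d n 𝔸 →ₗ[ℂ] (Site d → 𝔸))
  /-- (E1) right-inverse law of `G′`, pointwise ([4] Thm 3.1). -/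
  gp_right : ∀ n, 1 ≤ n → n ≤ m → ∀ x, ∀ y ∈ (Set.univ : Set (Site d)),
    (lapU n (Gp n x) + QpT n (Aw n (Qp n (Gp n x)))) y = x y
  /-- (E2) the law of `C` on the range of `Q′` ([4] (3.25)). -/
  cinv_range : ∀ n, 1 ≤ n → n ≤ m → ∀ f, Qp n (Gp n (Gp n (QpT n (Cinv n (Qp n f))))) = Qp n f
  /-- (E3) `Δ` IS the covariant Laplacian. -/
  lapU_reads : ∀ n, 1 ≤ n → n ≤ m → ∀ (f : Site d → 𝔸), ∀ x ∈ (Set.univ : Set (Site d)),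
    lapU n f x = covLap η U₀ ((Set.univ : Set (Site d)).indicator f) x
  /-- (E4) `Q′ᵀ` IS `QT` at `(n, torusLam n)`. -/
  qpT_reads : ∀ n, 1 ≤ n → n ≤ m → ∀ (μ : ℕ → Site d → 𝔸), ∀ x ∈ (Set.univ : Set (Site d)),
    QpT n μ x = QT L n (torusLam (d := d) n) U₀ μ x
  /-- (E5) `Q′` IS the iterated average at the tower sites of `torusLam n`. -/
  qp_reads : ∀ n, 1 ≤ n → n ≤ m → ∀ (f : Site d → 𝔸) (j : ℕ), j ≤ n → ∀ y ∈ torusLam (d := d) n j,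
    Qp n f j y = QprimeIter (zdBlocking d L) (bgT L U₀) j f y
  /-- (E6) (1.92), sup line for `H′`. -/
  hp_sup : ∀ n, 1 ≤ n → n ≤ m → ∀ (X : XSpace d n 𝔸) (x : Site d), ‖Hp n X x‖ ≤ B₀'H * ‖X‖
  /-- (E7) (1.92), weighted-gradient line for `H′`. -/
  hp_grad : ∀ n, 1 ≤ n → n ≤ m → ∀ j, j ≤ n → ∀ (X : XSpace d n 𝔸),
    ∀ p ∈ {b : Site d × Fin d | SideTouches (Set.univ : Set (Site d)) b.1 b.2},
      wt L η j * ‖covDerivFwd η U₀ p.2 (Hp n X) p.1‖ ≤ B₀'H * ‖X‖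
  /-- (E8) (1.92), `(−2)`-weighted Laplacian line for `H′`. -/
  hp_lap : ∀ n, 1 ≤ n → n ≤ m → ∀ X : XSpace d n 𝔸,
    Bd2 L η n (fun _ => (Set.univ : Set (Site d))) (covLap η U₀ (Hp n X)) (B₂' * ‖X‖)
  /-- (E9) Dirichlet range of `H′` (vacuous at `Ω₀ = ℤᵈ`, kept verbatim). -/
  hp_dirichlet : ∀ n, 1 ≤ n → n ≤ m → ∀ (X : XSpace d n 𝔸) (x : Site d), x ∉ (Set.univ : Set (Site d)) → Hp n X x = 0
  /-- (E10) reality of `H′`. -/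
  hp_real : ∀ n, 1 ≤ n → n ≤ m → ∀ X Y : XSpace d n 𝔸, (∀ p, Y p = -star (X p)) → ∀ x, Hp n Y x = -star (Hp n X x)
  /-- (E11) `Q′H′ = 1` at the tower sites ((1.91)). -/
  qp_hp : ∀ n, 1 ≤ n → n ≤ m → ∀ (Y : XSpace d n 𝔸) (j : ℕ) (hj : j ≤ n) (y : Site d), y ∈ torusLam (d := d) n j →
    QprimeIter (zdBlocking d L) (bgT L U₀) j (Hp n Y) y = Y (⟨j, Nat.lt_succ_of_le hj⟩, y)
  /-- (E12) (1.101) for `G′`: sup and weighted gradient ([4] Thm 3.1 (3.42)₁,₂ in [B8]'s norms). -/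
  gp_sup_grad : ∀ n, 1 ≤ n → n ≤ m → ∀ (f : Site d → 𝔸) (r : ℝ), 0 ≤ r → Bd2 L η n (fun _ => (Set.univ : Set (Site d))) f r →
    (∀ x, ‖Gp n f x‖ ≤ BG * r) ∧ ∀ j, j ≤ n → ∀ p ∈ {b : Site d × Fin d | SideTouches (Set.univ : Set (Site d)) b.1 b.2},
      wt L η j * ‖covDerivFwd η U₀ p.2 (Gp n f) p.1‖ ≤ BG * r
  /-- (E13) Dirichlet range of `G′` (vacuous at `Ω₀ = ℤᵈ`, kept verbatim). -/
  gp_dirichlet : ∀ n, 1 ≤ n → n ≤ m → ∀ (f : Site d → 𝔸) (x : Site d), x ∉ (Set.univ : Set (Site d)) → Gp n f x = 0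
  /-- (E14) reality of `G′`. -/
  gp_real : ∀ n, 1 ≤ n → n ≤ m → ∀ f : Site d → 𝔸,
    (∀ j, j ≤ n → ∀ x ∈ (Set.univ : Set (Site d)), IsSelfAdjoint (f x)) → ∀ x, IsSelfAdjoint (Gp n f x)
  /-- (E15) (1.98) for `R = 1 − G′Q′ᵀCQ′G′`. -/
  r_bound : ∀ n, 1 ≤ n → n ≤ m → ∀ (f : Site d → 𝔸) (r : ℝ), 0 ≤ r → Bd2 L η n (fun _ => (Set.univ : Set (Site d))) f r →
    Bd2 L η n (fun _ => (Set.univ : Set (Site d))) (f - Gp n (QpT n (Cinv n (Qp n (Gp n f))))) (BR * r)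
  /-- (E16) reality of `R`. -/
  r_real : ∀ n, 1 ≤ n → n ≤ m → ∀ f : Site d → 𝔸, (∀ j, j ≤ n → ∀ x ∈ (Set.univ : Set (Site d)), IsSelfAdjoint (f x)) →
    ∀ j, j ≤ n → ∀ x ∈ (Set.univ : Set (Site d)), IsSelfAdjoint ((f - Gp n (QpT n (Cinv n (Qp n (Gp n f))))) x)
  /-- (U1) [4] Thm 3.1's left-inverse law of `G′` ON BOUNDED FUNCTIONS, top structure. -/
  gp_left_bdd : 1 ≤ m → ∀ x : Site d → 𝔸, (∃ C : ℝ, ∀ y, ‖x y‖ ≤ C) → Gp m (lapU m x + QpT m (Aw m (Qp m x))) = x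
  /-- (U2) the law of `C` in the `Q′ᵀ`-form, top structure. -/
  cinv_range' : 1 ≤ m → ∀ φ, QpT m (Cinv m (Qp m (Gp m (Gp m (QpT m φ))))) = QpT m φ
  /-- (U3) `Q′ = 0` off `𝔅_m`, top structure. -/
  qp_zero_off : 1 ≤ m → ∀ (f : Site d → 𝔸) (j : ℕ) (y : Site d), ¬ (j ≤ m ∧ y ∈ torusLam (d := d) m j) → Qp m f j y = 0
  /-- (B) the in-edge b9 in Proposition 3's frame at truncation `m` ([4] Thm 3.3 ⇒ (1.59), p. 86), at `U₀`. -/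
  b9P3 : ∀ α₂ : ℝ, 0 < α₂ → α₂ ≤ cB →
    ∀ W : Site d → Fin d → 𝔸ˣ, (∀ x κ, W x κ ∈ unitaryUnits 𝔸) →
    InAk L m η α₀ (fun _ => (Set.univ : Set (Site d))) U₀ →
    InAk L m η α₀ (fun _ => (Set.univ : Set (Site d))) (mulCfg W U₀) →
    IsLandau138W L m η (Set.univ : Set (Site d)) (torusLam (d := d) m) U₀ W →
    ∀ A' : Site d → Fin d → 𝔸, (∀ y τ, IsSelfAdjoint (A' y τ)) →
    (∀ j, j ≤ m → ∀ (y : Site d) (τ : Fin d), SideTouches (Set.univ : Set (Site d)) y τ →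
      W y τ = cfgExp η A' y τ ∧ ‖A' y τ‖ ≤ α₂ * ((L : ℝ) ^ j * η)⁻¹) →
    (∀ (y : Site d) (τ : Fin d), (∀ j, j ≤ m → ¬ SideTouches (Set.univ : Set (Site d)) y τ) → A' y τ = 0) →
    msup L m η (-(1 : ℝ)) (fun _ (b : Site d × Fin d) => SideTouches (Set.univ : Set (Site d)) b.1 b.2) (fun b => A' b.1 b.2)
        ≤ B₀ * (bondNorm L m η (-(3 : ℝ)) (fun _ => (Set.univ : Set (Site d))) (fun x μ => Jcur η U₀ A' μ x)
          + wsup 1 (fun p : {p : ℕ × (Site d × Fin d) // p.1 ≤ m ∧ p.2 ∈ torusLamb (d := d) m p.1} =>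
              linCovIter L U₀ (iEta η A') p.1.1 p.1.2.1 p.1.2.2)) ∧
      msup L m η (-(2 : ℝ)) (fun _ (t : Fin d × Fin d × Site d) => SideTouches (Set.univ : Set (Site d)) t.2.2 t.2.1)
          (fun t => covDerivFwd η U₀ t.1 (fun z => A' z t.2.1) t.2.2)
        ≤ B₀ * (bondNorm L m η (-(3 : ℝ)) (fun _ => (Set.univ : Set (Site d))) (fun x μ => Jcur η U₀ A' μ x)
          + wsup 1 (fun p : {p : ℕ × (Site d × Fin d) // p.1 ≤ m ∧ p.2 ∈ torusLamb (d := d) m p.1} =>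
              linCovIter L U₀ (iEta η A') p.1.1 p.1.2.1 p.1.2.2)) ∧
      bondNorm L m η (-(3 : ℝ)) (fun _ => (Set.univ : Set (Site d))) (fun x μ => pdiv η U₀ (plaqCovDeriv η U₀ A') μ x)
        ≤ B₀ * (bondNorm L m η (-(3 : ℝ)) (fun _ => (Set.univ : Set (Site d))) (fun x μ => Jcur η U₀ A' μ x)
          + wsup 1 (fun p : {p : ℕ × (Site d × Fin d) // p.1 ≤ m ∧ p.2 ∈ torusLamb (d := d) m p.1} =>
              linCovIter L U₀ (iEta η A') p.1.1 p.1.2.1 p.1.2.2)) ∧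
      bondNorm L m η (-(3 : ℝ)) (fun _ => (Set.univ : Set (Site d))) (fun x μ => covLap η U₀ (fun z => A' z μ) x)
        ≤ B₀ * (bondNorm L m η (-(3 : ℝ)) (fun _ => (Set.univ : Set (Site d))) (fun x μ => Jcur η U₀ A' μ x)
          + wsup 1 (fun p : {p : ℕ × (Site d × Fin d) // p.1 ≤ m ∧ p.2 ∈ torusLamb (d := d) m p.1} =>
              linCovIter L U₀ (iEta η A') p.1.1 p.1.2.1 p.1.2.2)) ∧
      msup L m η (-(2 + β)) (fun _ (q : Fin d × Fin d × (Site d × Site d)) =>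
            q.2.2 ∈ AdmPair η len ∧ q.2.2.1 ∈ (Set.univ : Set (Site d)))
          (fun q => hquot η β len U₀ (covDerivFwd η U₀ q.1 (fun z => A' z q.2.1)) q.2.2)
        ≤ B₀β * (bondNorm L m η (-(3 : ℝ)) (fun _ => (Set.univ : Set (Site d))) (fun x μ => Jcur η U₀ A' μ x)
          + wsup 1 (fun p : {p : ℕ × (Site d × Fin d) // p.1 ≤ m ∧ p.2 ∈ torusLamb (d := d) m p.1} =>
              linCovIter L U₀ (iEta η A') p.1.1 p.1.2.1 p.1.2.2))

/-- **THE LETTERS AT EVERY BACKGROUND OF THE TORUS MEMBER `(η, k)`**: for every truncation `m ≤ k`, every regularity `0 < α₀ ≤ cL` and every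
unitary background `U₀ ∈ 𝔄_m({ℤᵈ}, α₀)`, the bundle `LettersAt … η m α₀ U₀` — the binder the `ℤᵈ` knit's sockets quantify over (all backgrounds
of the class on `ℤᵈ`, periodic or not; Theorem 4's truncations `m ≤ k`, p. 88 «the same conditions for k − 1»).  A `Type` of hypotheses, not a
`Prop` fact. [cite: Balaban1985RegularSpaces, Thm 4 p.88, Prop. 5 p.94, (1.59) p.86; Balaban1985BackgroundPropagators, Thms 3.1–3.3 pp.397–399] -/
def LettersAll (L : ℕ) (BG BR B₀'H B₂' B₀ B₀β cB β : ℝ) (len : Site d → ℝ) (cL : ℝ) (η : ℝ) (k : ℕ) : Type _ :=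
  ∀ m, m ≤ k → ∀ ⦃α₀ : ℝ⦄, 0 < α₀ → α₀ ≤ cL → ∀ U₀ : Site d → Fin d → 𝔸ˣ, (∀ x κ, U₀ x κ ∈ unitaryUnits 𝔸) →
    InAk L m η α₀ (fun _ => (Set.univ : Set (Site d))) U₀ → LettersAt (𝔸 := 𝔸) L BG BR B₀'H B₂' B₀ B₀β cB β len η m α₀ U₀

end Bundle

/-! ## §2  The knit's sockets at the torus members, served from the letters -/

section Servers

variable {𝔸 : Type*} [CStarAlgebra 𝔸]

/-- **The existence-side letters socket `SockLettersRD` at the torus structure `(Ω := ℤᵈ, Λs := torusLam)` from the bundle** (projection of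
the sixteen (E)-laws at the `k`-truncation). [cite: Balaban1985RegularSpaces, (1.91)–(1.103) pp.91–93; Balaban1985BackgroundPropagators, Thms 3.1–3.2 pp.397–398] -/
theorem sockLettersRD_of_letters {L : ℕ} {BG BR B₀'H B₂' B₀ B₀β cB β : ℝ} {len : Site d → ℝ} {cL η : ℝ} {k : ℕ}
    (Λ : LettersAll (𝔸 := 𝔸) (d := d) L BG BR B₀'H B₂' B₀ B₀β cB β len cL η k) :
    SockLettersRD (𝔸 := 𝔸) L BG BR B₀'H B₂' cL η k (fun _ => (Set.univ : Set (Site d))) (fun m => torusLam (d := d) m) := by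
  intro α₀ hα₀ hc U₀ hU₀ hA n hn hnk
  set Λ' := Λ k le_rfl hα₀ hc U₀ hU₀ hA with hΛ'
  exact ⟨Λ'.Gp n, Λ'.lapU n, Λ'.Qp n, Λ'.QpT n, Λ'.Aw n, Λ'.Cinv n, Λ'.Hp n, Λ'.gp_right n hn hnk, Λ'.cinv_range n hn hnk,
    Λ'.lapU_reads n hn hnk, Λ'.qpT_reads n hn hnk, Λ'.qp_reads n hn hnk, Λ'.hp_sup n hn hnk, Λ'.hp_grad n hn hnk, Λ'.hp_lap n hn hnk,
    Λ'.hp_dirichlet n hn hnk, Λ'.hp_real n hn hnk, Λ'.qp_hp n hn hnk, Λ'.gp_sup_grad n hn hnk, Λ'.gp_dirichlet n hn hnk, Λ'.gp_real n hn hnk,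
    Λ'.r_bound n hn hnk, Λ'.r_real n hn hnk⟩

/-- **The uniqueness-side letters binder of `B8LeafKnitZd3LettersRDB` (`SLetUB`, [4] Thm 3.1's left-inverse law on bounded functions) at the torus
structure from the bundle** (the SAME operators at the top truncation `k ≥ 1`: laws (U1)–(U3) + the shared (E)-laws).
[cite: Balaban1985RegularSpaces, Prop. 5 (1.109) p.94, (1.91)–(1.103) pp.91–93; Balaban1985BackgroundPropagators, Thm 3.1 p.397] -/
theorem lettersUB_of_letters {L : ℕ} {BG BR B₀'H B₂' B₀ B₀β cB β : ℝ} {len : Site d → ℝ} {cL η : ℝ} {k : ℕ} (hk : 1 ≤ k)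
    (Λ : LettersAll (𝔸 := 𝔸) (d := d) L BG BR B₀'H B₂' B₀ B₀β cB β len cL η k) :
    ∀ α₀ : ℝ, 0 < α₀ → α₀ ≤ cL → ∀ U₀ : Site d → Fin d → 𝔸ˣ, (∀ x κ, U₀ x κ ∈ unitaryUnits 𝔸) →
      InAk L k η α₀ (fun _ => (Set.univ : Set (Site d))) U₀ →
      ∃ (g Δ : (Site d → 𝔸) →ₗ[ℂ] (Site d → 𝔸)) (q : (Site d → 𝔸) →ₗ[ℂ] (ℕ → Site d → 𝔸)) (qs : (ℕ → Site d → 𝔸) →ₗ[ℂ] (Site d → 𝔸))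
        (Aw c : (ℕ → Site d → 𝔸) →ₗ[ℂ] (ℕ → Site d → 𝔸)) (H' : XSpace d k 𝔸 →ₗ[ℂ] (Site d → 𝔸)),
        (∀ x : Site d → 𝔸, (∃ C : ℝ, ∀ y, ‖x y‖ ≤ C) → g (Δ x + qs (Aw (q x))) = x) ∧ (∀ φ, qs (c (q (g (g (qs φ))))) = qs φ) ∧
        (∀ (f : Site d → 𝔸), ∀ x ∈ (fun _ => (Set.univ : Set (Site d))) 0,
          Δ f x = covLap η U₀ (((fun _ => (Set.univ : Set (Site d))) 0).indicator f) x) ∧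
        (∀ (μ : ℕ → Site d → 𝔸), ∀ x ∈ (fun _ => (Set.univ : Set (Site d))) 0,
          qs μ x = QT L k ((fun m => torusLam (d := d) m) k) U₀ μ x) ∧
        (∀ (f : Site d → 𝔸) (j : ℕ), j ≤ k → ∀ y ∈ (fun m => torusLam (d := d) m) k j,
          q f j y = QprimeIter (zdBlocking d L) (bgT L U₀) j f y) ∧
        (∀ (f : Site d → 𝔸) (j : ℕ) (y : Site d), ¬ (j ≤ k ∧ y ∈ (fun m => torusLam (d := d) m) k j) → q f j y = 0) ∧
        (∀ (X : XSpace d k 𝔸) (x : Site d), ‖H' X x‖ ≤ B₀'H * ‖X‖) ∧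
        (∀ j, j ≤ k → ∀ (X : XSpace d k 𝔸), ∀ p ∈ {b : Site d × Fin d | SideTouches ((fun _ => (Set.univ : Set (Site d))) j) b.1 b.2},
          wt L η j * ‖covDerivFwd η U₀ p.2 (H' X) p.1‖ ≤ B₀'H * ‖X‖) ∧
        (∀ X : XSpace d k 𝔸, Bd2 L η k (fun _ => (Set.univ : Set (Site d))) (covLap η U₀ (H' X)) (B₂' * ‖X‖)) ∧
        (∀ (Y : XSpace d k 𝔸) (j : ℕ) (hj : j ≤ k) (y : Site d), y ∈ (fun m => torusLam (d := d) m) k j →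
          QprimeIter (zdBlocking d L) (bgT L U₀) j (H' Y) y = Y (⟨j, Nat.lt_succ_of_le hj⟩, y)) ∧
        (∀ (f : Site d → 𝔸) (r : ℝ), 0 ≤ r → Bd2 L η k (fun _ => (Set.univ : Set (Site d))) f r →
          (∀ x, ‖g f x‖ ≤ BG * r) ∧ ∀ j, j ≤ k → ∀ p ∈ {b : Site d × Fin d | SideTouches ((fun _ => (Set.univ : Set (Site d))) j) b.1 b.2},
            wt L η j * ‖covDerivFwd η U₀ p.2 (g f) p.1‖ ≤ BG * r) ∧
        (∀ (f : Site d → 𝔸) (r : ℝ), 0 ≤ r → Bd2 L η k (fun _ => (Set.univ : Set (Site d))) f r →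
          Bd2 L η k (fun _ => (Set.univ : Set (Site d))) (f - g (qs (c (q (g f))))) (BR * r)) := by
  intro α₀ hα₀ hc U₀ hU₀ hA
  set Λ' := Λ k le_rfl hα₀ hc U₀ hU₀ hA with hΛ'
  exact ⟨Λ'.Gp k, Λ'.lapU k, Λ'.Qp k, Λ'.QpT k, Λ'.Aw k, Λ'.Cinv k, Λ'.Hp k, Λ'.gp_left_bdd hk, Λ'.cinv_range' hk,
    Λ'.lapU_reads k hk le_rfl, Λ'.qpT_reads k hk le_rfl, Λ'.qp_reads k hk le_rfl, Λ'.qp_zero_off hk, Λ'.hp_sup k hk le_rfl,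
    Λ'.hp_grad k hk le_rfl, Λ'.hp_lap k hk le_rfl, Λ'.qp_hp k hk le_rfl, Λ'.gp_sup_grad k hk le_rfl, Λ'.r_bound k hk le_rfl⟩

/-- **The in-edge b9 in Proposition 3's frame `SockB9P3` at every truncation `m ≤ k` of the torus structure from the bundle** (threshold
`min cL cB`). [cite: Balaban1985RegularSpaces, (1.57)–(1.59) p.86; Balaban1985BackgroundPropagators, Thm 3.3 p.399] -/
theorem sockB9P3_of_letters {L : ℕ} {BG BR B₀'H B₂' B₀ B₀β cB β : ℝ} {len : Site d → ℝ} {cL η : ℝ} {k : ℕ}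
    (Λ : LettersAll (𝔸 := 𝔸) (d := d) L BG BR B₀'H B₂' B₀ B₀β cB β len cL η k) :
    ∀ m, m ≤ k → SockB9P3 (𝔸 := 𝔸) L B₀ B₀β (min cL cB) β len η m (fun _ => (Set.univ : Set (Site d)))
      (fun m => torusLam (d := d) m) (fun m => torusLamb (d := d) m) := by
  intro m hm α₀ α₂ hα₀ hα₀c hα₂ hα₂c U₀ W hU₀ hW hA hWA hLan A' hsa hexp hoff
  set Λ' := Λ m hm hα₀ (hα₀c.trans (min_le_left _ _)) U₀ hU₀ hA with hΛ'
  exact Λ'.b9P3 α₂ hα₂ (hα₂c.trans (min_le_right _ _)) W hW hA hWA hLan A' hsa hexp hoff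

/-- **The index laws of the torus member** used by the socket providers: `Ω_j = ℤᵈ` antitone (trivially), `Ω₀ = ℤᵈ`, towers ⊂ `Ω_j` (trivially),
index law №8 («we take Λ_{k−1} ∪ B(Λ_k) as Λ_{k−1}», p. 89) for `torusLam`: below the top both structures are empty, and every site of the
`m`-lattice lies in the block of its successor. [cite: Balaban1985RegularSpaces, p.89, (1.28) p.81, p.77 («Ω_j = T_η»)] -/
theorem torus_member_laws {L : ℕ} (hL : 2 ≤ L) (k : ℕ) :
    (∀ j : ℕ, (fun _ => (Set.univ : Set (Site d))) (j + 1) ⊆ (fun _ => (Set.univ : Set (Site d))) j) ∧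
    ((fun _ => (Set.univ : Set (Site d))) 0 = Set.univ) ∧
    (∀ m, m ≤ k → ∀ n, n ≤ m → ∀ y ∈ (fun m => torusLam (d := d) m) m n, ∀ x : Site d,
      InBox (tlo L y n) (thi L y n) x → x ∈ (fun _ => (Set.univ : Set (Site d))) n) ∧
    (∀ m, m < k → ∀ n, n < m → (fun m => torusLam (d := d) m) m n = (fun m => torusLam (d := d) m) (m + 1) n) ∧
    (∀ m, m < k → ∀ x : Site d, x ∈ (fun m => torusLam (d := d) m) m m ↔
      x ∈ (fun m => torusLam (d := d) m) (m + 1) m ∨ ∃ y ∈ (fun m => torusLam (d := d) m) (m + 1) (m + 1), x ∈ blockSites L y) := by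
  haveI : NeZero L := ⟨by omega⟩
  refine ⟨fun _ => subset_rfl, rfl, fun _ _ _ _ _ _ _ _ => Set.mem_univ _, ?_, ?_⟩
  · intro m _ n hn
    show torusLam (d := d) m n = torusLam (d := d) (m + 1) n
    rw [torusLam_of_ne (Nat.ne_of_lt hn), torusLam_of_ne (by omega)]
  · intro m _ x
    show x ∈ torusLam (d := d) m m ↔ x ∈ torusLam (d := d) (m + 1) m ∨ ∃ y ∈ torusLam (d := d) (m + 1) (m + 1), x ∈ blockSites L y
    refine ⟨fun _ => Or.inr ⟨blockMap L x, (mem_torusLam_iff (m + 1) (m + 1) _).2 rfl, (mem_blockSites_iff L _ x).2 rfl⟩,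
      fun _ => (mem_torusLam_iff m m x).2 rfl⟩

end Servers

/-! ## §3  Theorem 2 at the torus members, modulo the letters -/

section Thm2

variable {𝔸 : Type} [CStarAlgebra 𝔸] [Nontrivial 𝔸]

/-- **THE KNIT'S FOUR SOCKETS AT EVERY TORUS MEMBER, SERVED FROM THE LETTERS WITH ONE THRESHOLD TRIPLE**: for `d, L ≥ 2`, the socket constants
and the free-constant condition `3·(2dL²)·B_G·B_R ≤ B₀′` there are `cF, cu′, cu > 0` such that at EVERY torus member `t` carrying `LettersAll …
cL t.η t.k`: Proposition 5's fixed points `SockHFP₀`∕`SockHFP` (threshold `cF`; `B8SockHFPRD.exists_threshold_sockHFP_pairRD`), its uniqueness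
socket `SockP5uE` (threshold `cu′`, radius `cu`; `B8SockP5uEAssemblyB.exists_threshold_sockP5uEB`) and the in-edge b9 `SockB9P3` at every
truncation (threshold `min cL cB`). [cite: Balaban1985RegularSpaces, Prop. 5 p.94, Thm 4 p.88, (1.59) p.86; Balaban1985BackgroundPropagators, Thms 3.1–3.3 pp.397–399] -/
theorem sockets_of_letters (hd2 : 2 ≤ d) {L : ℕ} (hL : 2 ≤ L) {B₀ B₀' B₀'H B₂' BG BR B₀β cB β cL : ℝ} {len : Site d → ℝ}
    (hB₀ : 0 < B₀) (hB₀' : 0 < B₀') (hB : 2 ≤ 5 * (d : ℝ) * L * B₀) (hB₀'H : 0 < B₀'H) (hB₂' : 0 ≤ B₂') (hBG : 0 ≤ BG) (hBR : 0 ≤ BR)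
    (hcB : 0 < cB) (hcL : 0 < cL) (hfree : 3 * (2 * (d : ℝ) * (L : ℝ) ^ 2) * BG * BR ≤ B₀') :
    ∃ cF cu' cu : ℝ, 0 < cF ∧ 0 < cu' ∧ 0 < cu ∧ ∀ t : TorusMember,
      LettersAll (𝔸 := 𝔸) (d := d) L BG BR B₀'H B₂' B₀ B₀β cB β len cL t.η t.k →
      SockHFP₀ (𝔸 := 𝔸) L B₀ B₀' cF (torusIdx (d := d) (le_trans one_le_two hL) t).η (torusIdx (d := d) (le_trans one_le_two hL) t).k
          (torusIdx (d := d) (le_trans one_le_two hL) t).Ω (torusIdx (d := d) (le_trans one_le_two hL) t).Λs ∧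
        SockHFP (𝔸 := 𝔸) L B₀ B₀' cF (torusIdx (d := d) (le_trans one_le_two hL) t).η (torusIdx (d := d) (le_trans one_le_two hL) t).k
          (torusIdx (d := d) (le_trans one_le_two hL) t).Ω (torusIdx (d := d) (le_trans one_le_two hL) t).Λs ∧
        SockP5uE (𝔸 := 𝔸) L B₀ cu' cu (torusIdx (d := d) (le_trans one_le_two hL) t).η (torusIdx (d := d) (le_trans one_le_two hL) t).k
          (torusIdx (d := d) (le_trans one_le_two hL) t).Ω (torusIdx (d := d) (le_trans one_le_two hL) t).Λs ∧
        ∀ m, m ≤ (torusIdx (d := d) (le_trans one_le_two hL) t).k →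
          SockB9P3 (𝔸 := 𝔸) L B₀ B₀β (min cL cB) β len (torusIdx (d := d) (le_trans one_le_two hL) t).η m
            (torusIdx (d := d) (le_trans one_le_two hL) t).Ω (torusIdx (d := d) (le_trans one_le_two hL) t).Λs
            (torusIdx (d := d) (le_trans one_le_two hL) t).Λb := by
  have hcLB : 0 < min cL cB := lt_min hcL hcB
  obtain ⟨cF, hcF, hpair⟩ := exists_threshold_sockHFP_pairRD (𝔸 := 𝔸) (B₀ := B₀) (B₀' := B₀') hd2 hL hB₀ hB₀' hB hB₀'H hB₂' hBG hBR hcLB hcL hfree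
  obtain ⟨cu, cFu, hcu, hcFu, huniq⟩ := exists_threshold_sockP5uEB (𝔸 := 𝔸) hd2 hL hB₀ hB hB₀'H hB₂' hBG hBR hcLB hcL
  refine ⟨cF, cFu, cu, hcF, hcFu, hcu, fun t Λ => ?_⟩
  set i : ZdIdx d L := torusIdx (d := d) (le_trans one_le_two hL) t with hi
  obtain ⟨_, hΩ0, hL1, hL2lt, hL2top⟩ := torus_member_laws (d := d) hL t.k
  have SLet : SockLettersRD (𝔸 := 𝔸) L BG BR B₀'H B₂' cL i.η i.k i.Ω i.Λs := sockLettersRD_of_letters Λ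
  have SB9all : ∀ m, m ≤ i.k → SockB9P3 (𝔸 := 𝔸) L B₀ B₀β (min cL cB) β len i.η m i.Ω i.Λs i.Λb := sockB9P3_of_letters Λ
  have h := hpair i.hη i.hk i.hΩ i.hbox i.hclass hL1 hL2lt hL2top SLet SB9all
  exact ⟨h.1, h.2, huniq i.hη i.hk i.hΩ hΩ0 i.hbox i.hclass (hL1 i.k le_rfl) (lettersUB_of_letters t.hk Λ) SB9all, SB9all⟩

/-- **THEOREM 2 (p. 83) AT EVERY TORUS MEMBER, BOTH HALVES, MODULO THE LETTERS** (`zdGF3` currency): p33's `B8Thm2TorusMember.thm2_torus_of_socketsE`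
with its four sockets served by `sockets_of_letters` — ONE triple `B₁, B₂, c₁ > 0` such that at every torus member carrying `LettersAll`, for
`α₀, α₁ > 0` with `α₀ + α₁ ≤ c₁` and unitary data with (1.33)–(1.35), there is EXACTLY ONE restricted `u` with (1.36)–(1.39) for `U′^{u⁻¹}`.
Remaining hypotheses: the letters at every torus member ([4] Thms 3.1–3.3 at every background of the class), `3·(2dL²)·B_G·B_R ≤ B₀′`, positive
constants.  Theorem 2 on `T_η` LOCALISED to the [B9] §3 letters; nothing of [4] proved.
[cite: Balaban1985RegularSpaces, Thm 2 p.83, (1.33)–(1.39) pp.82–83, Thm 4 p.88, Prop. 5 p.94; Balaban1985BackgroundPropagators, Thms 3.1–3.3 pp.397–399] -/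
theorem thm2_torus_of_letters (hd2 : 2 ≤ d) {L : ℕ} (hL : 2 ≤ L) {B₀ B₀' B₀'H B₂' BG BR B₀β cB β cL : ℝ} {len : Site d → ℝ}
    (hB₀ : 0 < B₀) (hB₀' : 0 < B₀') (hB₀β : 0 < B₀β) (hB : 2 ≤ 5 * (d : ℝ) * L * B₀) (hB₀'H : 0 < B₀'H) (hB₂' : 0 ≤ B₂')
    (hBG : 0 ≤ BG) (hBR : 0 ≤ BR) (hcB : 0 < cB) (hcL : 0 < cL) (hfree : 3 * (2 * (d : ℝ) * (L : ℝ) ^ 2) * BG * BR ≤ B₀')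
    (Λ : ∀ t : TorusMember, LettersAll (𝔸 := 𝔸) (d := d) L BG BR B₀'H B₂' B₀ B₀β cB β len cL t.η t.k) :
    ∃ B₁ B₂ c₁ : ℝ, 0 < B₁ ∧ 0 < B₂ ∧ 0 < c₁ ∧
      ∀ t : TorusMember,
        ∀ α₀ α₁ : ℝ, 0 < α₀ → 0 < α₁ → α₀ + α₁ ≤ c₁ →
          ∀ (U₀ : (zdGF3 𝔸 L β len (torusIdx (d := d) (le_trans one_le_two hL) t)).Cfg)
            (P : (zdGF3 𝔸 L β len (torusIdx (d := d) (le_trans one_le_two hL) t)).Pert),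
            (zdGF3 𝔸 L β len (torusIdx (d := d) (le_trans one_le_two hL) t)).InA α₀ U₀ →
            (zdGF3 𝔸 L β len (torusIdx (d := d) (le_trans one_le_two hL) t)).Reg335 α₀ U₀ →
            (zdGF3 𝔸 L β len (torusIdx (d := d) (le_trans one_le_two hL) t)).InAAx α₀ U₀ P →
            (∀ j, j ≤ t.k → ∀ (z : Site d) (μ : Fin d), BondTouches (torusLam (d := d) t.k j) z μ →
              (∀ x, InBox (loK L j z) (bondHiK L j z μ) x → x ∈ (Set.univ : Set (Site d))) →
              ‖(avgIter L (mulCfg P.2.1 U₀.1) j z μ : 𝔸) - (avgIter L U₀.1 j z μ : 𝔸)‖ ≤ α₁) →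
            ∃ u : (zdGF3 𝔸 L β len (torusIdx (d := d) (le_trans one_le_two hL) t)).GT,
              (zdGF3 𝔸 L β len (torusIdx (d := d) (le_trans one_le_two hL) t)).Restricted U₀ u ∧
              ((zdGF3 𝔸 L β len (torusIdx (d := d) (le_trans one_le_two hL) t)).C136 B₁ B₂ (α₀ + (11 * (d : ℝ) ^ 2 * α₀ + α₁)) U₀
                  ((zdGF3 𝔸 L β len (torusIdx (d := d) (le_trans one_le_two hL) t)).act P u) ∧
                (zdGF3 𝔸 L β len (torusIdx (d := d) (le_trans one_le_two hL) t)).C137 α₁ U₀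
                  ((zdGF3 𝔸 L β len (torusIdx (d := d) (le_trans one_le_two hL) t)).act P u) ∧
                (zdGF3 𝔸 L β len (torusIdx (d := d) (le_trans one_le_two hL) t)).Landau U₀
                  ((zdGF3 𝔸 L β len (torusIdx (d := d) (le_trans one_le_two hL) t)).act P u) ∧
                (zdGF3 𝔸 L β len (torusIdx (d := d) (le_trans one_le_two hL) t)).C139 B₁ (α₀ + (11 * (d : ℝ) ^ 2 * α₀ + α₁)) U₀
                  ((zdGF3 𝔸 L β len (torusIdx (d := d) (le_trans one_le_two hL) t)).act P u)) ∧
              ∀ u' : (zdGF3 𝔸 L β len (torusIdx (d := d) (le_trans one_le_two hL) t)).GT,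
                (zdGF3 𝔸 L β len (torusIdx (d := d) (le_trans one_le_two hL) t)).Restricted U₀ u' →
                (zdGF3 𝔸 L β len (torusIdx (d := d) (le_trans one_le_two hL) t)).C136 B₁ B₂ (α₀ + (11 * (d : ℝ) ^ 2 * α₀ + α₁)) U₀
                  ((zdGF3 𝔸 L β len (torusIdx (d := d) (le_trans one_le_two hL) t)).act P u') →
                (zdGF3 𝔸 L β len (torusIdx (d := d) (le_trans one_le_two hL) t)).C137 α₁ U₀
                  ((zdGF3 𝔸 L β len (torusIdx (d := d) (le_trans one_le_two hL) t)).act P u') →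
                (zdGF3 𝔸 L β len (torusIdx (d := d) (le_trans one_le_two hL) t)).Landau U₀
                  ((zdGF3 𝔸 L β len (torusIdx (d := d) (le_trans one_le_two hL) t)).act P u') →
                (zdGF3 𝔸 L β len (torusIdx (d := d) (le_trans one_le_two hL) t)).C139 B₁ (α₀ + (11 * (d : ℝ) ^ 2 * α₀ + α₁)) U₀
                  ((zdGF3 𝔸 L β len (torusIdx (d := d) (le_trans one_le_two hL) t)).act P u') →
                  u' = u := by
  obtain ⟨cF, cu', cu, hcF, hcu', hcu, S⟩ :=
    sockets_of_letters (𝔸 := 𝔸) (β := β) (len := len) hd2 hL hB₀ hB₀' hB hB₀'H hB₂' hBG hBR hcB hcL hfree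
  exact thm2_torus_of_socketsE (𝔸 := 𝔸) hd2 hL hB₀ hB₀' hB₀β hB hcu hcF hcF hcu' (lt_min hcL hcB)
    (fun t => (S t (Λ t)).1) (fun t => (S t (Λ t)).2.1) (fun t => (S t (Λ t)).2.2.1) (fun t => (S t (Λ t)).2.2.2)

/-- **THE EXISTENCE HALF OF THE INTERFACE OF RECORD `B8Thm2TorusAt` AT EVERY TORUS MEMBER, MODULO THE LETTERS** (route K): p33's
`B8Thm2TorusAtSupplier.thm2TorusAt_exists_of_socketsE` with its four sockets served by `sockets_of_letters` — ONE triple `B₁, B₂, c₁ > 0` such that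
at every torus member `t` carrying `LettersAll`, every torus side `P = Lᵏ·N`, for `α₀, α₁ > 0` with `α₀ + α₁ ≤ c₁` and `P`-periodic unitary data
with (1.33), (1.34), (1.35) (`Hyp135` on the top lattice), there is a `P`-periodic unitary restricted `u` with `Concl2T L k P η 0 B₁ B₂ len α₀ α₁ U₀ U′ u`
((1.36)–(1.39) for `U′^{u⁻¹} = e^{iηA}`, `A` self-adjoint and `P`-periodic, Hölder datum `β₀ = 0`).  THEOREM 2 ON `T_η` LOCALISED TO THE [B9] §3
LETTERS; `G = unitaryUnits` (SU(N): joint J-SU); nothing of [4] proved; `stub_PV3A` NOT discharged.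
[cite: Balaban1985RegularSpaces, Thm 2 p.83, (1.33)–(1.39) pp.82–83, p.77 («Ω_j = T_η»), Thm 4 p.88, Prop. 5 p.94; Balaban1985BackgroundPropagators, Thms 3.1–3.3 pp.397–399] -/
theorem thm2TorusAt_exists_of_letters_K (hd2 : 2 ≤ d) {L : ℕ} (hL : 2 ≤ L) {B₀ B₀' B₀'H B₂' BG BR B₀β cB β cL : ℝ} {len : Site d → ℝ}
    (hB₀ : 0 < B₀) (hB₀' : 0 < B₀') (hB₀β : 0 < B₀β) (hB : 2 ≤ 5 * (d : ℝ) * L * B₀) (hB₀'H : 0 < B₀'H) (hB₂' : 0 ≤ B₂')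
    (hBG : 0 ≤ BG) (hBR : 0 ≤ BR) (hcB : 0 < cB) (hcL : 0 < cL) (hfree : 3 * (2 * (d : ℝ) * (L : ℝ) ^ 2) * BG * BR ≤ B₀')
    (Λ : ∀ t : TorusMember, LettersAll (𝔸 := 𝔸) (d := d) L BG BR B₀'H B₂' B₀ B₀β cB β len cL t.η t.k) :
    ∃ B₁ B₂ c₁ : ℝ, 0 < B₁ ∧ 0 < B₂ ∧ 0 < c₁ ∧
      ∀ t : TorusMember, ∀ N : ℤ, ∀ α₀ α₁ : ℝ, 0 < α₀ → 0 < α₁ → α₀ + α₁ ≤ c₁ →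
        ∀ U₀ U' : Site d → Fin d → 𝔸ˣ, (∀ x κ, U₀ x κ ∈ unitaryUnits 𝔸) → (∀ x κ, U' x κ ∈ unitaryUnits 𝔸) →
          (∀ i : Fin d, shiftCfg ((((L : ℤ) ^ t.k * N)) • e i) U₀ = U₀) → (∀ i : Fin d, shiftCfg ((((L : ℤ) ^ t.k * N)) • e i) U' = U') →
          InAk L t.k t.η α₀ (fun _ => Set.univ) U₀ →
          InAk L t.k t.η α₀ (fun _ => Set.univ) (U' * U₀) → InAx L t.k (torusLam t.k) U₀ (U' * U₀) →
          Hyp135 L t.k (torusLam t.k) α₁ U₀ U' →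
          ∃ u : Site d → 𝔸ˣ, (∀ x, u x ∈ unitaryUnits 𝔸) ∧ (∀ (x : Site d) (i : Fin d), u (x + (((L : ℤ) ^ t.k * N)) • e i) = u x) ∧
            Restr129 L t.k (torusLam t.k) U₀ u ∧
            Concl2T L t.k ((L : ℤ) ^ t.k * N) t.η 0 B₁ B₂ len α₀ α₁ U₀ U' u := by
  obtain ⟨cF, cu', cu, hcF, hcu', hcu, S⟩ :=
    sockets_of_letters (𝔸 := 𝔸) (β := β) (len := len) hd2 hL hB₀ hB₀' hB hB₀'H hB₂' hBG hBR hcB hcL hfree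
  exact thm2TorusAt_exists_of_socketsE (𝔸 := 𝔸) hd2 hL hB₀ hB₀' hB₀β hB hcu hcF hcF hcu' (lt_min hcL hcB)
    (fun t => (S t (Λ t)).1) (fun t => (S t (Λ t)).2.1) (fun t => (S t (Λ t)).2.2.1) (fun t => (S t (Λ t)).2.2.2)

end Thm2

/-! ## §4  v2 (lead RULING #3 (3), 2026-08-28): the PERIODIC binder of route P and the J-SU `τ`-add-on -/

section PeriodicAndTau

variable {𝔸 : Type*} [CStarAlgebra 𝔸]

/-- **THE LETTERS AT ALL TORUS MEMBERS `≤ k`, KEYED TO `P`-PERIODIC `G`-VALUED BACKGROUNDS (v2 binder of route P)** — what the composition of record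
actually consumes (lead RULING #3 (3): «`LettersAt` should quantify over P-PERIODIC backgrounds at torus members, not every `InAk` background on
`ℤᵈ`»): for every truncation `m ≤ k`, every `0 < α₀ ≤ c_L` and every background `U₀` that is `G`-valued, `P`-periodic (`U₀(x + P e_i) = U₀(x)`; on the
torus of side `P = LᵏM` these are print's configurations on `T_η`, p. 77 «Ω_j = T_η») and satisfies (1.33)/(1.34) at `m` levels on the whole lattice,
the [4] letters `LettersAt … m α₀ U₀`.  The `ℤᵈ` binder `LettersAll` (every unitary `InAk` background) is route K's cross-check binder and implies this one
for `G ≤ U(𝔸)` (`lettersAllP_of_lettersAll`). [cite: Balaban1985RegularSpaces, Thm 2 p.83, p.77 («Ω_j = T_η»), (1.33)–(1.34) p.82;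
Balaban1985BackgroundPropagators, Thm 3.1 p.397, Thms 3.2–3.3 pp.397–398] -/
def LettersAllP (L : ℕ) (BG BR B₀'H B₂' B₀ B₀β cB β : ℝ) (len : Site d → ℝ) (cL : ℝ) (η : ℝ) (k : ℕ) (P : ℤ) (G : Subgroup 𝔸ˣ) :
    Type _ :=
  ∀ m, m ≤ k → ∀ ⦃α₀ : ℝ⦄, 0 < α₀ → α₀ ≤ cL → ∀ U₀ : Site d → Fin d → 𝔸ˣ, (∀ x κ, U₀ x κ ∈ G) →
    (∀ (x : Site d) (i : Fin d), U₀ (x + P • e i) = U₀ x) →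
    InAk L m η α₀ (fun _ => (Set.univ : Set (Site d))) U₀ → LettersAt (𝔸 := 𝔸) L BG BR B₀'H B₂' B₀ B₀β cB β len η m α₀ U₀

/-- Route K's `ℤᵈ` binder serves route P's periodic binder for any `G ≤ U(𝔸)` (it asks strictly more backgrounds).
[cite: Balaban1985RegularSpaces, Thm 2 p.83, p.77] -/
def lettersAllP_of_lettersAll {L : ℕ} {BG BR B₀'H B₂' B₀ B₀β cB β : ℝ} {len : Site d → ℝ} {cL η : ℝ} {k : ℕ} (P : ℤ)
    {G : Subgroup 𝔸ˣ} (hG : G ≤ unitaryUnits 𝔸) (ℓ : LettersAll (𝔸 := 𝔸) L BG BR B₀'H B₂' B₀ B₀β cB β len cL η k) :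
    LettersAllP (𝔸 := 𝔸) L BG BR B₀'H B₂' B₀ B₀β cB β len cL η k P G :=
  fun m hm _ h0 hc U₀ hU₀ _ hA => ℓ m hm h0 hc U₀ (fun x κ => hG (hU₀ x κ)) hA

/-- **J-SU ADD-ON TO THE LETTERS: `τ`-COMPATIBILITY OF `H′`, `G′` AND `R = 1 − G′Q′ᵀCQ′G′`** (joint J-SU of sub-row «G-B8-T2S»; print p. 76: for
`G = SU(N)` all configurations are `𝔤 = 𝔰𝔲(N)`-valued, so [4]'s linear operators — built from covariant derivatives and `U₀`-conjugated averages —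
map trace-free configurations to trace-free ones): for a continuous linear functional `τ`, «`τ`-free in ⇒ `τ`-free out» for `Hp n`, `Gp n` and the
(1.98) remainder at every truncation `1 ≤ n ≤ m`, in exactly the shapes `hHτ`/`hGτ`/`hRτ` consumed by `B8SectETraceFree.hFP_kLevel_of_sectE_local'_RD_traceFree`
(with `Ω_j = T_η` = `univ`).  A law about the letters, asserted for nothing; automatic for letters built from `covDerivFwd`/`covLap`/`QT`/`QprimeIter`
by `τ`-cyclicity (`B8Prop5GaugeParamTraceFree.apply_covLap`, `B8SectERemainderTraceFree.apply_lamAvgG`).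
[cite: Balaban1985RegularSpaces, p.76, (1.17) p.78, (1.91)–(1.92) p.91, (1.95)–(1.98) p.92] -/
structure LettersTau (τ : 𝔸 →L[ℂ] ℂ) {L : ℕ} {BG BR B₀'H B₂' B₀ B₀β cB β : ℝ} {len : Site d → ℝ} {η : ℝ} {m : ℕ} {α₀ : ℝ}
    {U₀ : Site d → Fin d → 𝔸ˣ} (lt : LettersAt (𝔸 := 𝔸) L BG BR B₀'H B₂' B₀ B₀β cB β len η m α₀ U₀) : Prop where
  /-- `H′` maps `τ`-free families to `τ`-free configurations. -/
  hp_tau : ∀ n, 1 ≤ n → n ≤ m → ∀ X : XSpace d n 𝔸, (∀ p, τ (X p) = 0) → ∀ x, τ (lt.Hp n X x) = 0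
  /-- `G′` maps `τ`-free configurations to `τ`-free configurations. -/
  gp_tau : ∀ n, 1 ≤ n → n ≤ m → ∀ f : Site d → 𝔸,
    (∀ j, j ≤ n → ∀ x ∈ (Set.univ : Set (Site d)), τ (f x) = 0) → ∀ x, τ (lt.Gp n f x) = 0
  /-- `R = 1 − G′Q′ᵀCQ′G′` maps `τ`-free configurations to `τ`-free configurations. -/
  r_tau : ∀ n, 1 ≤ n → n ≤ m → ∀ f : Site d → 𝔸,
    (∀ j, j ≤ n → ∀ x ∈ (Set.univ : Set (Site d)), τ (f x) = 0) →
      ∀ j, j ≤ n → ∀ x ∈ (Set.univ : Set (Site d)), τ ((f - lt.Gp n (lt.QpT n (lt.Cinv n (lt.Qp n (lt.Gp n f))))) x) = 0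

/-- **The `τ`-add-on at all periodic torus members**: `LettersTau τ` for every member of a `LettersAllP` family.
[cite: Balaban1985RegularSpaces, p.76, (1.91)–(1.98) pp.91–92] -/
def LettersAllPTau (τ : 𝔸 →L[ℂ] ℂ) {L : ℕ} {BG BR B₀'H B₂' B₀ B₀β cB β : ℝ} {len : Site d → ℝ} {cL η : ℝ} {k : ℕ} {P : ℤ}
    {G : Subgroup 𝔸ˣ} (ℓ : LettersAllP (𝔸 := 𝔸) L BG BR B₀'H B₂' B₀ B₀β cB β len cL η k P G) : Prop :=
  ∀ (m : ℕ) (hm : m ≤ k) (α₀ : ℝ) (h0 : 0 < α₀) (hc : α₀ ≤ cL) (U₀ : Site d → Fin d → 𝔸ˣ) (hU₀ : ∀ x κ, U₀ x κ ∈ G)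
    (hP : ∀ (x : Site d) (i : Fin d), U₀ (x + P • e i) = U₀ x) (hA : InAk L m η α₀ (fun _ => (Set.univ : Set (Site d))) U₀),
    LettersTau (𝔸 := 𝔸) τ (ℓ m hm h0 hc U₀ hU₀ hP hA)

end PeriodicAndTau

#print axioms sockets_of_letters
#print axioms thm2_torus_of_letters
#print axioms thm2TorusAt_exists_of_letters_K

end Literature.MathematicalPhysics.QuantumFieldTheory.Balaban1983to89.B8Thm2TorusLetters

end
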